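import Literature.Geometry.DiscreteGeometry.ThreePointEnergyBound
import Literature.Geometry.DiscreteGeometry.ThreePointKernelDimThree
import Summits.Ventures.PackingBounds.Energy.FivePointThomsonSOS
import HarnessLib

/-!
# Thomson's problem for five electrons: `Σ_{x≠y} 1/‖x-y‖ ≥ 1 + 6√2 + 2√3` on `S²`, by an exact sharp three-point certificate

Framing: lottery ticket; floor = certified bounds/negative ranges. Venture `PackingBounds`, cell
`pub-packcert`, energy family E3PT (pub-packcert-energy gen 11).

**Theorem** (`thomson_five_points`). For every set `C` of five unit vectors of `ℝ³`,
`Σ_{x ≠ y ∈ C} 1/‖x - y‖ ≥ 1 + 6√2 + 2√3` (ordered pairs; `= 2·(1/2 + 3√2 + √3)`, twice the Coulomb energy of the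
triangular bipyramid, which attains the bound). The statement — the five-electron case of Thomson's 1904 problem —
is a known theorem (R. E. Schwartz, *The five-electron case of Thomson's problem*, Exp. Math. 22 (2013) 157–186),
proved there by a large computer-assisted subdivision. The proof here is different and short given the data: the
Bachoc–Vallentin / Cohn–Woo THREE-point semidefinite bound is SHARP for this problem, and its optimal dual solution
is an explicit degree-4 certificate with all scalars in `ℚ(√2,√3)` found by the cell's exact pipeline
(`pub-packcert-energy/E3PT.md`; certificate `certs/e3pt/e3pt-sharp-n3N5s1d4K-none.json`; verified independently by two exact readers).
Ingredients: `CohnWoo.energy_ge_of_threePoint` (Cohn–Woo 2012 Thm 3.2), Bachoc–Vallentin positivity on `S²`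
(`tripleSum_threePointF3_nonneg`), the Hermite minorant `pminK(1 - m²/2) ≤ 1/m` on `(0,2]` via the factorisation
`1 - m·p(1-m²/2) = (2-m)(m-√2)²(m-√3)²·q(m)` with `q` having positive coefficients, and the Gram identity
`rexp_eq`/`quadK_nonneg` of `FivePointThomsonSOS`. `√2`, `√3` enter every polynomial identity linearly (atoms for
`ring`) except the Hermite factorisation (`linear_combination` with the relations `s2² = 2`, `s3² = 3`).
-/

noncomputable section

open Finset
open scoped RealInnerProductSpace

namespace Summit.Ventures.PackingBounds.Energy.FivePointThomson

open Literature.Geometry.DiscreteGeometry Literature.Geometry.DiscreteGeometry.BachocVallentin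
open Literature.Analysis.SpecialFunctions

set_option maxHeartbeats 4000000 in
/-- The Hermite factorisation `1 - m·p(1 - m²/2) = (2-m)(m-√2)²(m-√3)²·q(m)` (the nodes `t = -1, -1/2, 0` are
`m = ‖x-y‖ = 2, √3, √2`). -/
theorem one_sub_mul_pmin (m : ℝ) :
    1 - m * pminK (1 - m ^ 2 / 2) = (2 - m) * (m - s2) ^ 2 * (m - s3) ^ 2 * qaux m := by
  unfold pminK qaux
  have hs2 : s2 ^ 2 = 2 := Real.sq_sqrt (by norm_num)
  have hs3 : s3 ^ 2 = 3 := Real.sq_sqrt (by norm_num)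
  linear_combination (((-1 : ℝ)/6) * s3^2 + ((1 : ℝ)/3) * m * s3 + ((3 : ℝ)/4) * m * s3^2 + ((35 : ℝ)/9) * m * s3^3 + ((-65 : ℝ)/12) * m * s2 * s3^2 + ((-1 : ℝ)/6) * m^2 + ((-3 : ℝ)/2) * m^2 * s3 + ((5 : ℝ)/36) * m^2 * s3^2 + ((1 : ℝ)/2) * m^2 * s3^3 + ((65 : ℝ)/6) * m^2 * s2 * s3 + ((3 : ℝ)/4) * m^2 * s2 * s3^2 + ((7 : ℝ)/18) * m^2 * s2 * s3^3 + ((3 : ℝ)/4) * m^3 + ((-215 : ℝ)/18) * m^3 * s3 + ((-15 : ℝ)/8) * m^3 * s3^2 + ((-73 : ℝ)/18) * m^3 * s3^3 + ((-65 : ℝ)/12) * m^3 * s2 + ((-3 : ℝ)/2) * m^3 * s2 * s3 + ((281 : ℝ)/144) * m^3 * s2 * s3^2 + ((1 : ℝ)/2) * m^3 * s2 * s3^3 + ((95 : ℝ)/12) * m^4 + ((9 : ℝ)/4) * m^4 * s3 + ((197 : ℝ)/72) * m^4 * s3^2 + ((-3 : ℝ)/4) * m^4 * s3^3 + ((3 :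 ℝ)/4) * m^4 * s2 + ((-365 : ℝ)/72) * m^4 * s2 * s3 + ((-3 : ℝ)/4) * m^4 * s2 * s3^2 + ((-25 : ℝ)/72) * m^4 * s2 * s3^3 + ((-7 : ℝ)/8) * m^5 + ((241 : ℝ)/36) * m^5 * s3 + ((9 : ℝ)/8) * m^5 * s3^2 + ((13 : ℝ)/12) * m^5 * s3^3 + ((131 : ℝ)/48) * m^5 * s2 + ((19 : ℝ)/144) * m^5 * s2 * s3^2 + ((-43 : ℝ)/8) * m^6 + ((-25 : ℝ)/24) * m^6 * s3^2 + ((1 : ℝ)/4) * m^6 * s2 + ((7 : ℝ)/9) * m^6 * s2 * s3 + ((-3 : ℝ)/8) * m^7 + ((-7 : ℝ)/6) * m^7 * s3 + ((-9 : ℝ)/16) * m^7 * s2 + ((9 : ℝ)/8) * m^8) * hs2 + (((-1 : ℝ)/3) + ((3 : ℝ)/2) * m + ((70 : ℝ)/9) * m * s3 + ((-21 : ℝ)/2) * m * s2 + ((1 : ℝ)/9) * m^2 + (1 : ℝ) * m^2 * s3 + ((-7) : ℝ) * m^2 * s2 * s3 + ((-3) : ℝ) * m^3 + ((-38 : ℝ)/9)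 * m^3 * s3 + ((159 : ℝ)/8) * m^3 * s2 + ((-47 : ℝ)/9) * m^4 + ((-1) : ℝ) * m^4 * s3 + ((25 : ℝ)/4) * m^4 * s2 * s3 + ((15 : ℝ)/8) * m^5 + ((-10 : ℝ)/9) * m^5 * s3 + ((-177 : ℝ)/16) * m^5 * s2 + ((41 : ℝ)/9) * m^6 + ((1 : ℝ)/4) * m^6 * s3 + ((-9 : ℝ)/8) * m^6 * s2 * s3 + ((-3 : ℝ)/8) * m^7 + ((7 : ℝ)/18) * m^7 * s3 + ((27 : ℝ)/16) * m^7 * s2 + ((-7 : ℝ)/9) * m^8) * hs3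

/-- `q(m) ≥ 0` for `m ≥ 0`: all five coefficients of `q` are positive elements of `ℚ(√2,√3)`. -/
theorem qaux_nonneg (m : ℝ) (hm : 0 ≤ m) : 0 ≤ qaux m := by
  have q0 : (0:ℝ) ≤ (((1 : ℝ)/12) + (0 : ℝ) * s2 + (0 : ℝ) * s3 + (0 : ℝ) * (s2 * s3)) := kval_nonneg _ _ _ _ (by norm_num)
  have q1 : (0:ℝ) ≤ (((-1 : ℝ)/3) + ((65 : ℝ)/24) * s2 + ((-35 : ℝ)/18) * s3 + (0 : ℝ) * (s2 * s3)) := kval_nonneg _ _ _ _ (by norm_num)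
  have q2 : (0:ℝ) ≤ (((31 : ℝ)/24) + ((47 : ℝ)/48) * s2 + ((-11 : ℝ)/9) * s3 + ((-7 : ℝ)/36) * (s2 * s3)) := kval_nonneg _ _ _ _ (by norm_num)
  have q3 : (0:ℝ) ≤ (((1 : ℝ)/3) + ((-7 : ℝ)/8) * s2 + ((37 : ℝ)/36) * s3 + ((-25 : ℝ)/72) * (s2 * s3)) := kval_nonneg _ _ _ _ (by norm_num)
  have q4 : (0:ℝ) ≤ (((1 : ℝ)/8) + ((-9 : ℝ)/16) * s2 + ((7 : ℝ)/18) * s3 + (0 : ℝ) * (s2 * s3)) := kval_nonneg _ _ _ _ (by norm_num)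
  have hq : qaux m = (((1 : ℝ)/12) + (0 : ℝ) * s2 + (0 : ℝ) * s3 + (0 : ℝ) * (s2 * s3)) + (((-1 : ℝ)/3) + ((65 : ℝ)/24) * s2 + ((-35 : ℝ)/18) * s3 + (0 : ℝ) * (s2 * s3)) * m + (((31 : ℝ)/24) + ((47 : ℝ)/48) * s2 + ((-11 : ℝ)/9) * s3 + ((-7 : ℝ)/36) * (s2 * s3)) * m ^ 2 + (((1 : ℝ)/3) + ((-7 : ℝ)/8) * s2 + ((37 : ℝ)/36) * s3 + ((-25 : ℝ)/72) * (s2 * s3)) * m ^ 3 + (((1 : ℝ)/8) + ((-9 : ℝ)/16) * s2 + ((7 : ℝ)/18) * s3 + (0 : ℝ) * (s2 * s3)) * m ^ 4 := by unfold qaux; ring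
  rw [hq]
  exact (add_nonneg (add_nonneg (add_nonneg (add_nonneg q0 (mul_nonneg q1 hm)) (mul_nonneg q2 (pow_nonneg hm 2))) (mul_nonneg q3 (pow_nonneg hm 3))) (mul_nonneg q4 (pow_nonneg hm 4)))

/-- **Hermite minorant of the Coulomb potential.** For `0 < m ≤ 2`: `p(1 - m²/2) ≤ 1/m`, i.e. `p(⟪x,y⟫) ≤ 1/‖x-y‖`
for distinct unit vectors. -/
theorem pmin_le (m : ℝ) (h0 : 0 < m) (h2 : m ≤ 2) : pminK (1 - m ^ 2 / 2) ≤ 1 / m := by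
  rw [le_div_iff₀ h0]
  have hid := one_sub_mul_pmin m
  have hq := qaux_nonneg m h0.le
  have hprod : 0 ≤ (2 - m) * (m - s2) ^ 2 * (m - s3) ^ 2 * qaux m :=
    mul_nonneg (mul_nonneg (mul_nonneg (by linarith) (sq_nonneg _)) (sq_nonneg _)) hq
  linarith

/-- Two-point coefficients as a function (`a_0 = 0`, `a_1 = a1K`). -/
def acoK : ℕ → ℝ
  | 1 => a1K
  | _ => 0

/-- `a₁ ≥ 0` (an element of `ℚ(√2,√3)` of value ≈ 5.5·10⁻⁴). -/
theorem a1_nonneg : 0 ≤ a1K := by unfold a1K; exact kval_nonneg _ _ _ _ (by norm_num)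

/-- The two-point coefficients are nonnegative. -/
theorem aco_nonneg (k : ℕ) : 0 ≤ acoK k := by
  unfold acoK; split
  · exact a1_nonneg
  · norm_num

/-- The weights `d_{k,r}` are nonnegative (rational ones by `norm_num`, `ℚ(√2,√3)` ones by `kval_nonneg`). -/
theorem dco_nonneg (k r : ℕ) : 0 ≤ dcoK k r := by
  unfold dcoK; split <;> first | exact kval_nonneg _ _ _ _ (by norm_num) | norm_num

/-- `chebHom 2` unfolded. -/
private theorem chebHom_two (xT wT : ℝ) : chebHom 2 xT wT = xT * (xT / 2) - wT := by
  simp [chebHom]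

/-- `chebHom 3` unfolded. -/
private theorem chebHom_three (xT wT : ℝ) : chebHom 3 xT wT = xT * (xT * (xT / 2) - wT) - wT * (xT / 2) := by
  simp [chebHom]

set_option maxRecDepth 20000 in
set_option maxHeartbeats 40000000 in
/-- The tree's factored three-point function (Bachoc–Vallentin kernels on `S²`, nonnegative weights `dcoK`, weight
polynomials `gwK`) equals `FexpK` (`ring`; the weights in `ℚ(√2,√3)` enter linearly). -/
theorem threePointF3_eq (u v t : ℝ) : threePointF3 4 15 dcoK gwK u v t = FexpK u v t := by
  simp only [threePointF3, Finset.sum_range_succ, Finset.sum_range_zero, sym6, Q3, dcoK, gwK, chebHom_two,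
    chebHom_three, zero_add, zero_mul, add_zero]
  simp only [chebHom, FexpK]
  ring

/-- The value of the bound: `5(4c - F(1,1,1) - a₁) = 1 + 6√2 + 2√3`, the Coulomb energy of the triangular
bipyramid over ordered pairs (distances `2` once, `√2` six times, `√3` three times among unordered pairs). -/
theorem bound_eq : (5 : ℝ) * ((5 - 1) * c0K - FexpK 1 1 1 - a1K * 1) = 1 + 6 * s2 + 2 * s3 := by
  unfold c0K FexpK a1K; ring

/-- **Thomson's problem for five electrons (sharp three-point bound).** For every five unit vectors `C ⊂ ℝ³`:
`Σ_{x ≠ y ∈ C} 1/‖x-y‖ ≥ 1 + 6√2 + 2√3`, the value of the triangular bipyramid (ordered pairs). -/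
theorem thomson_five_points (C : Finset (EuclideanSpace ℝ (Fin 3))) (hC : ∀ x ∈ C, ‖x‖ = 1)
    (h5 : C.card = 5) :
    1 + 6 * Real.sqrt 2 + 2 * Real.sqrt 3 ≤ ∑ x ∈ C, ∑ y ∈ C.erase x, 1 / ‖x - y‖ := by
  classical
  have hA := pairSum_gegenbauer_comb_nonneg (n := 3) (by norm_num) 1 acoK aco_nonneg C hC
  have hF := tripleSum_threePointF3_nonneg 4 15 dcoK dco_nonneg gwK C hC
  have hcard : (C.card : ℝ) = 5 := by exact_mod_cast h5
  have hAeval : ∀ w : ℝ, (∑ k ∈ range (1 + 1), acoK k * gegenbauerSum ((((3 : ℕ) : ℝ) - 2) / 2) k w)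
      = a1K * w := by
    intro w
    have h0 : acoK 0 = 0 := rfl
    have h1 : acoK 1 = a1K := rfl
    simp only [Finset.sum_range_succ, Finset.sum_range_zero, h0, h1, gegenbauerSum_one, gegenbauerSum_zero]
    push_cast
    ring
  have hineq : ∀ u v t : ℝ, -1 ≤ u → u < 1 → -1 ≤ v → v < 1 → -1 ≤ t → t < 1 →
      0 ≤ 1 + 2 * u * v * t - u ^ 2 - v ^ 2 - t ^ 2 →
      c0K + ((C.card : ℝ) - 2) * threePointF3 4 15 dcoK gwK u v t + threePointF3 4 15 dcoK gwK u u 1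
        + threePointF3 4 15 dcoK gwK v v 1 + threePointF3 4 15 dcoK gwK t t 1
        + ((fun w => ∑ k ∈ range (1 + 1), acoK k * gegenbauerSum ((((3 : ℕ) : ℝ) - 2) / 2) k w) u
          + (fun w => ∑ k ∈ range (1 + 1), acoK k * gegenbauerSum ((((3 : ℕ) : ℝ) - 2) / 2) k w) v
          + (fun w => ∑ k ∈ range (1 + 1), acoK k * gegenbauerSum ((((3 : ℕ) : ℝ) - 2) / 2) k w) t) / 3
        ≤ (pminK u + pminK v + pminK t) / 3 := by
    intro u v t hu1 hu2 hv1 hv2 ht1 ht2 hdet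
    simp only [hAeval, hcard, threePointF3_eq]
    have h1 := slack_nonneg u v t
    linarith
  have key := CohnWoo.energy_ge_of_threePoint C hC (by omega) pminK _ _ c0K hA hF
    (threePointF3_swap12 4 15 dcoK gwK) (threePointF3_swap23 4 15 dcoK gwK) hineq
  simp only [hAeval, hcard, threePointF3_eq] at key
  rw [bound_eq] at key
  have hs : 1 + 6 * Real.sqrt 2 + 2 * Real.sqrt 3 = 1 + 6 * s2 + 2 * s3 := rfl
  rw [hs]
  refine key.trans (Finset.sum_le_sum fun x hx => Finset.sum_le_sum fun y hy => ?_)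
  have hyC : y ∈ C := Finset.mem_of_mem_erase hy
  have hxy : x ≠ y := fun h => (Finset.ne_of_mem_erase hy) h.symm
  have hnorm : ‖x - y‖ ^ 2 = 2 - 2 * inner ℝ x y := by
    rw [@norm_sub_sq_real, hC x hx, hC y hyC]; ring
  have hpos : 0 < ‖x - y‖ := norm_pos_iff.2 (sub_ne_zero.2 hxy)
  have hle : ‖x - y‖ ≤ 2 := by
    calc ‖x - y‖ ≤ ‖x‖ + ‖y‖ := norm_sub_le x y
      _ = 2 := by rw [hC x hx, hC y hyC]; norm_num
  have hin : inner ℝ x y = 1 - ‖x - y‖ ^ 2 / 2 := by linarith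
  rw [hin]
  exact pmin_le _ hpos hle

/-- The same bound over unordered pairs, in the form usually quoted for Thomson's problem:
`Σ_{x≠y} 1/‖x-y‖ = 2·E_Coulomb(C)`, so `E_Coulomb(C) ≥ 1/2 + 3√2 + √3 ≈ 6.4747`. -/
theorem thomson_five_points_half (C : Finset (EuclideanSpace ℝ (Fin 3))) (hC : ∀ x ∈ C, ‖x‖ = 1)
    (h5 : C.card = 5) :
    1 / 2 + 3 * Real.sqrt 2 + Real.sqrt 3 ≤ (∑ x ∈ C, ∑ y ∈ C.erase x, 1 / ‖x - y‖) / 2 := by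
  have h := thomson_five_points C hC h5
  linarith

end Summit.Ventures.PackingBounds.Energy.FivePointThomson
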